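import Summits.BirchSwinnertonDyer.BirchSwinnertonDyer.Theorems.SmallImageMuTransferMuTransferX9SelmerDualStub
import HarnessLib

/-!
# The K6 `μ`-core under IMAGE FACTS instead of `ρ̄` not onto — part F: MU-TRANSFER-PROOF STEP 1, Selmer side
# (the registered stub `stub_selmerDualOdd`) WITHOUT the binder `¬ W.HasSurjectiveModNGaloisRep p`
# (route `KatoDescentPotSupersingular`, U₀ parent item stmt-BirchSwinnertonDyer-19197 / U₀-ns node 19189;
# route-free helper)

Seat `bsd-potss-k9-c4` g14 (prover; cell `bsd-potss`); `--supports stmt-BirchSwinnertonDyer-19197 --as helper`;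
closes nothing.  HONEST FRAMING: BSD is not proved by any of this; nothing is booked; THEOREMS ONLY; the
mathematics and the proof texts are the K6 cells' (`bsd-smallim` lur-a/lur-b/k6-g4/k6-c2, `b2b-bsdres` x9/x10:
`…X9SelmerDualLocalBad`, `…X9SelmerDualLocalUnramified`, `…X9SelmerDualStub`; MU-TRANSFER-PROOF §5 STEP 1,
Selmer side).  k9-c4 g14's census of the core: the binder `¬Surj` of the Selmer-dual stub is VACUOUS — `localBad`,
`localUnramified`, `localP` introduce it as `_` and the assemblies only forward it.  This file re-elaborates the
four pieces with the binder deleted: `localBadIrr`, `localUnramifiedIrr`, `localPIrr`, and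
**`stub_selmerDualIrr_holds`** — the stub for EVERY `E/ℚ` with `E[p]` irreducible and `p ≠ 2` (9-deficient rows
at `p = 3` included).

References: [GreenbergLNM1716] §3; [MazurRubin2004] §5.3; [MilneADT2006] I Thm. 4.10; [Rubin2000] §4.4.
-/

set_option linter.dupNamespace false
set_option autoImplicit false

noncomputable section

open scoped Classical NumberField
open Field IsDedekindDomain Function
open WeierstrassCurve (geomTorsion geomPrimaryTorsion)
open Literature.NumberTheory.GaloisRepresentations
open Literature.NumberTheory.GaloisCohomology
open Literature.NumberTheory.EllipticCurves
open Literature.NumberTheory.EllipticCurves.GreenbergSelmer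

universe u

namespace Summit.BirchSwinnertonDyer.BirchSwinnertonDyer.Rank1Residual.SelmerDual

/-! ## §1 The three local inputs without the binder -/

/-- (Twin of `localBad` with the vacuous binder `ρ̄_{E,p}` not onto deleted; proof text verbatim.) **(L-bad) of `stub_selmerDualOdd_of_local`, discharged**: at every place `v ∤ p` there is a uniform
`ε_v` with `loc_v ((κ⁻¹.shiftH1)^[ε_v] c) = 0` for all levels `J` and all `c ∈ H¹(ℚ, 𝒯_J(E, κ⁻¹))`
(k6-g4's uniform local exponent at the singleton `{v}`).
[cite: MilneADT2006, Ch. I §2, Thm. 2.8 (p. 31)] [cite: GreenbergLNM1716, §1] -/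
theorem localBadIrr :
    ∀ (W : WeierstrassCurve ℚ) [W.IsElliptic] [W.IsGloballyMinimal] (p : ℕ) [Fact p.Prime]
      (κ : ZpExtension ℚ p) (γ : absoluteGaloisGroup ℚ),
      p ≠ 2 → W.HasIrreducibleModPGaloisRep p →
      κ.IsCyclotomic → κ.IsTopGenerator γ →
      (∀ v : HeightOneSpectrum (𝓞 ℚ), localEulerPoincareCharacteristic (v.adicCompletion ℚ)) →
      poitouTate_sum_localTatePairing_eq_zero ℚ →
      ∀ v : HeightOneSpectrum (𝓞 ℚ), ((p : ℕ) : 𝓞 ℚ) ∉ v.asIdeal →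
        ∃ εv : ℕ, ∀ (J : ℕ) (c : galoisCohomology (W.modPTwist p κ.invTwist J) 1),
          galoisCohomology.localization (W.modPTwist p κ.invTwist J) (Sum.inr v) 1
            ((κ.invTwist.shiftH1 (W.torsionGaloisModule (p : ℤ))
              (fun P : WeierstrassCurve.geomTorsion W (p : ℤ) => AddSubgroup.torsionBy.nsmul P) J)^[εv] c) = 0 := by
  intro W _ _ p _ κ _ _ _ hκ _ _ _ v hv
  obtain ⟨ε, hε⟩ :=
    LocalSplitPrime.exists_uniform_localization_shiftH1_modPTwist_invTwist_of_isCyclotomic W p κ hκ {v}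
      (fun v' hv' => by rwa [Finset.mem_singleton.mp hv'])
  exact ⟨ε, fun J c => hε le_rfl v (Finset.mem_singleton_self v) J c⟩

/-- (Twin of `localUnramified` with the vacuous binder `ρ̄_{E,p}` not onto deleted; proof text verbatim.) **(L-ur) of `stub_selmerDualOdd_of_local`, with the binder `W.HasGoodReductionAt v` added** (see the
module docstring for why the verbatim binder is not a target): for the cyclotomic data of the stub, a finite
place `v ∤ p` of `ℚ` at which `E[p]` is unramified AND `E` has good reduction, a fine class
`y ∈ H¹(ℚ_∞, E[p])` and the data `y_n, Y, Ψ, k` tied to `y` by the assembly's three relations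
(`res y_n = res y`, `Sh(Y) = y_n`, `T^{p^n−J−1}· Ψ = T^k Y`), the localisation of `Ψ` at `v` lies in
`H¹_ur(ℚ_v, 𝒯_{J+1}(E, κ⁻¹))`.  Steps: fine ⟹ `res_{I_𝔓} y = 0` (Castella (B′), AEC X.4.4 / VIII.1.4;
`I_𝔓 ≤ Gal(ℚ̄/ℚ_∞)`, Washington 13.2) ⟹ a cocycle of `y_n` vanishes on every `Γ_n ∩ I_𝔓` ⟹ so does one of
`Y = coresShapiro n y_n` (x9 `CoresUnramified`) ⟹ so does every cocycle of `Ψ` (coboundaries die on `I_𝔓`,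
`T`-embedding injective) ⟹ `loc_v Ψ ∈ H¹_ur` (k6-g3 `KolyvaginTwist`).
[cite: SilvermanAEC2009, Cor. X.4.4 (proof of Thm. X.4.2(b))] [cite: Washington1997, Prop. 13.2]
[cite: SerreGaloisCohomology1997, I §2.5 Prop. 10] [cite: MilneADT2006, Ch. I §2 (unramified cohomology)] -/
theorem localUnramifiedIrr :
    ∀ (W : WeierstrassCurve ℚ) [W.IsElliptic] [W.IsGloballyMinimal] (p : ℕ) [Fact p.Prime]
      (κ : ZpExtension ℚ p) (γ : absoluteGaloisGroup ℚ),
      p ≠ 2 → W.HasIrreducibleModPGaloisRep p →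
      κ.IsCyclotomic → κ.IsTopGenerator γ →
      ∀ (v : HeightOneSpectrum (𝓞 ℚ)), ((p : ℕ) : 𝓞 ℚ) ∉ v.asIdeal →
        GaloisRep.IsUnramifiedAt v (W.torsionGaloisModule (p : ℤ)) → W.HasGoodReductionAt v →
        ∀ (J n : ℕ) (hJn : J + 1 ≤ p ^ n)
          (y : Literature.NumberTheory.EllipticCurves.subgroupH1 κ.kerSubgroup
            (WeierstrassCurve.geomTorsion W (p : ℤ))),
          W.torsionToPrimaryH1Sub p κ.kerSubgroup y ∈ W.fineSelmerInfty κ →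
          ∀ (yn : Literature.NumberTheory.EllipticCurves.subgroupH1 (κ.invTwist.layerSubgroup n)
              (WeierstrassCurve.geomTorsion W (p : ℤ)))
            (Y : galoisCohomology (W.modPTwist p κ.invTwist (p ^ n)) 1)
            (Ψ : galoisCohomology (W.modPTwist p κ.invTwist (J + 1)) 1) (k : ℕ),
            Literature.NumberTheory.EllipticCurves.resOfLe (WeierstrassCurve.geomTorsion W (p : ℤ))
                (κ.invTwist.kerSubgroup_le_layerSubgroup n) yn =
              Literature.NumberTheory.EllipticCurves.resOfLe (WeierstrassCurve.geomTorsion W (p : ℤ))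
                (κ.kerSubgroup_unitTwist (-1)).le y →
            κ.invTwist.twistModPH1Equiv (W.torsionGaloisModule (p : ℤ))
              (fun P : WeierstrassCurve.geomTorsion W (p : ℤ) => AddSubgroup.torsionBy.nsmul P) n Y = yn →
            galoisCohomology.map (κ.invTwist.twistModPShiftEmbed (W.torsionGaloisModule (p : ℤ))
              (fun P : WeierstrassCurve.geomTorsion W (p : ℤ) => AddSubgroup.torsionBy.nsmul P) (p ^ n) hJn)
                1 Ψ =
              (κ.invTwist.shiftH1 (W.torsionGaloisModule (p : ℤ))
                (fun P : WeierstrassCurve.geomTorsion W (p : ℤ) => AddSubgroup.torsionBy.nsmul P)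
                (p ^ n))^[k] Y →
            galoisCohomology.localization (W.modPTwist p κ.invTwist (J + 1)) (Sum.inr v) 1 Ψ ∈
              DiscreteGaloisModule.unramifiedSubgroup
                (GaloisRep.toLocal v (W.modPTwist p κ.invTwist (J + 1))) 1 := by
  intro W _ _ p _ κ _ _ _ _ _ v hvp hvur hgood J n hJn y hy yn Y Ψ k hyn hSh hΨemb
  letI : Fintype (absoluteGaloisGroup ℚ ⧸ κ.invTwist.layerSubgroup n) := κ.invTwist.fintypeQuotientLayer n
  -- notation
  set ρ : DiscreteGaloisModule ℚ (geomTorsion W (p : ℤ)) := W.torsionGaloisModule (p : ℤ) with hρ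
  have hM : ∀ P : geomTorsion W (p : ℤ), p • P = 0 := fun P => AddSubgroup.torsionBy.nsmul P
  -- the inertia groups above `v` lie in `Gal(ℚ̄/ℚ_∞) = ker κ = ker κ⁻¹ ≤ Γ_n(κ⁻¹)`
  have hIker : ∀ 𝔓 ∈ v.primesAbove, 𝔓.inertia (absoluteGaloisGroup ℚ) ≤ κ.kerSubgroup :=
    fun 𝔓 h𝔓 => ZpExtension.inertia_le_kerSubgroup_holds ℚ p κ hvp h𝔓
  have hIlayer : ∀ 𝔓 ∈ v.primesAbove,
      𝔓.inertia (absoluteGaloisGroup ℚ) ≤ κ.invTwist.layerSubgroup n := fun 𝔓 h𝔓 =>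
    ((hIker 𝔓 h𝔓).trans (κ.kerSubgroup_unitTwist (-1)).ge).trans
      (κ.invTwist.kerSubgroup_le_layerSubgroup n)
  -- `E[p]` unramified at `v`: the inertia groups above `v` act trivially
  have hfix : ∀ 𝔓 ∈ v.primesAbove, ∀ τ ∈ 𝔓.inertia (absoluteGaloisGroup ℚ),
      ∀ P : geomTorsion W (p : ℤ), τ • P = P := fun 𝔓 h𝔓 τ hτ P => by
    rw [← W.torsionGaloisModule_apply_apply (p : ℤ) τ P, hvur 𝔓 h𝔓 τ hτ]
    rfl
  -- STEP 1: `y` fine ⟹ `res_{I_𝔓} y = 0` (Castella (B′); good reduction at `v ∤ p`)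
  have hfine : ∀ σ : absoluteGaloisGroup ℚ,
      W.conjH1 p κ.kerSubgroup σ (W.torsionToPrimaryH1Sub p κ.kerSubgroup y) ∈
        GreenbergSelmer.awayKer κ.kerSubgroup (geomPrimaryTorsion W p) v :=
    fun σ => ((GreenbergSelmer.mem_strictSelmerGroupOver_iff _).1 hy).1 v hvp σ
  have hbad : v ∉ W.badPlaces (𝓞 ℚ) := fun h => (W.mem_badPlaces_iff v).1 h hgood
  have hres_y : ∀ 𝔓 (h𝔓 : 𝔓 ∈ v.primesAbove),
      Literature.NumberTheory.EllipticCurves.resOfLe (geomTorsion W (p : ℤ)) (hIker 𝔓 h𝔓) y = 0 :=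
    fun 𝔓 h𝔓 => Castella2018.AcSelmer.resOfLe_torsion_eq_zero_of_forall_conjH1_mem_awayKer
      (H := κ.kerSubgroup) hfine hbad hvp h𝔓 (hIker 𝔓 h𝔓)
  -- … transported to `y_n` (`res y_n = res y`)
  have hres_yn : ∀ 𝔓 (h𝔓 : 𝔓 ∈ v.primesAbove),
      Literature.NumberTheory.EllipticCurves.resOfLe (geomTorsion W (p : ℤ)) (hIlayer 𝔓 h𝔓) yn = 0 := by
    intro 𝔓 h𝔓
    have hI' : 𝔓.inertia (absoluteGaloisGroup ℚ) ≤ κ.invTwist.kerSubgroup :=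
      (hIker 𝔓 h𝔓).trans (κ.kerSubgroup_unitTwist (-1)).ge
    have e1 : Literature.NumberTheory.EllipticCurves.resOfLe (geomTorsion W (p : ℤ)) (hIlayer 𝔓 h𝔓) yn =
        Literature.NumberTheory.EllipticCurves.resOfLe (geomTorsion W (p : ℤ)) hI'
          (Literature.NumberTheory.EllipticCurves.resOfLe (geomTorsion W (p : ℤ))
            (κ.invTwist.kerSubgroup_le_layerSubgroup n) yn) := by
      rw [← AddMonoidHom.comp_apply, resOfLe_comp_holds (M := geomTorsion W (p : ℤ)) hI'
        (κ.invTwist.kerSubgroup_le_layerSubgroup n)]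
    rw [e1, hyn, ← AddMonoidHom.comp_apply, resOfLe_comp_holds (M := geomTorsion W (p : ℤ)) hI'
      (κ.kerSubgroup_unitTwist (-1)).le]
    exact hres_y 𝔓 h𝔓
  -- … and made pointwise on a cocycle `f` of `y_n` (`I_𝔓` acts trivially on `E[p]`)
  obtain ⟨f, hf⟩ :=
    oneCocycleClass_surjective (subgroupRep ρ.toTopRep (κ.invTwist.layerSubgroup n)) yn
  have hf0 : ∀ 𝔓 ∈ v.primesAbove, ∀ g : κ.invTwist.layerSubgroup n,
      (g : absoluteGaloisGroup ℚ) ∈ 𝔓.inertia (absoluteGaloisGroup ℚ) → f.1 g = 0 := by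
    intro 𝔓 h𝔓 g hg
    have h0 := hres_yn 𝔓 h𝔓
    rw [← hf] at h0
    obtain ⟨a, ha⟩ := (resOfLe_oneCocycleClass_eq_zero_iff (M := geomTorsion W (p : ℤ))
      (κ.invTwist.layerSubgroup n) (hIlayer 𝔓 h𝔓) f).1 h0
    have h1 := ha ⟨g, hg⟩
    rw [hfix 𝔓 h𝔓 g hg a, sub_self] at h1
    exact h1
  -- STEP 2: `Y = coresShapiro n y_n` has a cocycle `F` vanishing on every `I_𝔓`, `𝔓 ∣ v` (x9)
  obtain ⟨F, hF, hF0⟩ := CoresUnramified.exists_cocycle_coresShapiro_apply_eq_zero_of_forall_primesAbove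
    κ.invTwist ρ hM n hvp f hf0
  rw [hf] at hF
  have hY : Y = κ.invTwist.coresShapiro ρ hM n yn := by
    rw [← hSh, κ.invTwist.coresShapiro_twistModPH1Equiv]
  have hFY : oneCocycleClass _ F = Y := hF.trans hY.symm
  subst hFY
  -- STEP 3: every cocycle `ψ` of `Ψ` vanishes on every `I_𝔓`, `𝔓 ∣ v`
  obtain ⟨ψ, rfl⟩ := oneCocycleClass_surjective (W.modPTwist p κ.invTwist (J + 1)).toTopRep Ψ
  have hact : ∀ 𝔓 ∈ v.primesAbove, ∀ τ ∈ 𝔓.inertia (absoluteGaloisGroup ℚ),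
      ∀ x : Fin (p ^ n) → geomTorsion W (p : ℤ), κ.invTwist.twistModP ρ hM (p ^ n) τ x = x := by
    intro 𝔓 h𝔓 τ hτ x
    rw [κ.invTwist.twistModP_apply_of_mem_layerSubgroup ρ hM (p ^ n) (m := n)
      (Nat.lt_pow_self (Fact.out : p.Prime).one_lt).le le_rfl (hIlayer 𝔓 h𝔓 hτ)]
    funext i
    rw [hρ, W.torsionGaloisModule_apply_apply]
    exact hfix 𝔓 h𝔓 τ hτ (x i)
  have hψ0 : ∀ 𝔓 ∈ v.primesAbove, ∀ τ ∈ 𝔓.inertia (absoluteGaloisGroup ℚ), ψ.1 τ = 0 :=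
    fun 𝔓 h𝔓 => apply_eq_zero_of_map_shiftEmbed_eq_shiftH1_iterate κ.invTwist ρ hM hJn k ψ F hΨemb
      (hact 𝔓 h𝔓) (hF0 𝔓 h𝔓)
  -- STEP 4: a global cocycle vanishing on `I_{𝔓₀}` has unramified localisation (k6-g3)
  exact KolyvaginTwist.localization_mem_unramifiedSubgroup_of_forall_inertia_apply_eq_zero
    (W.modPTwist p κ.invTwist (J + 1)) v ψ (hψ0 _ (adicCompletionPrime_mem_primesAbove ℚ v))

/-- (Twin of `localP` with the vacuous binder `ρ̄_{E,p}` not onto deleted; proof text verbatim.) **(L-p): the hypothesis `hLp` of `SelmerDual.stub_selmerDualOdd_of_local(P)`, VERBATIM** — the uniform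
local exponent at the place above `p` for the Selmer-side classes `Ψ` built from FINE classes `y`.
[cite: GreenbergLNM1716, §3] [cite: MazurRubin2004, §5.3] -/
theorem localPIrr :
    ∀ (W : WeierstrassCurve ℚ) [W.IsElliptic] [W.IsGloballyMinimal] (p : ℕ) [Fact p.Prime]
      (κ : ZpExtension ℚ p) (γ : absoluteGaloisGroup ℚ),
      p ≠ 2 → W.HasIrreducibleModPGaloisRep p →
      κ.IsCyclotomic → κ.IsTopGenerator γ →
      (∀ v : HeightOneSpectrum (𝓞 ℚ), localEulerPoincareCharacteristic (v.adicCompletion ℚ)) →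
      poitouTate_sum_localTatePairing_eq_zero ℚ →
      ∃ εp : ℕ, ∀ (v : HeightOneSpectrum (𝓞 ℚ)), ((p : ℕ) : 𝓞 ℚ) ∈ v.asIdeal →
        ∀ (J n : ℕ) (hJn : J + 1 ≤ p ^ n)
          (y : Literature.NumberTheory.EllipticCurves.subgroupH1 κ.kerSubgroup
            (WeierstrassCurve.geomTorsion W (p : ℤ))),
          W.torsionToPrimaryH1Sub p κ.kerSubgroup y ∈ W.fineSelmerInfty κ →
          ∀ (yn : Literature.NumberTheory.EllipticCurves.subgroupH1 (κ.invTwist.layerSubgroup n)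
              (WeierstrassCurve.geomTorsion W (p : ℤ)))
            (Y : galoisCohomology (W.modPTwist p κ.invTwist (p ^ n)) 1)
            (Ψ : galoisCohomology (W.modPTwist p κ.invTwist (J + 1)) 1) (k : ℕ),
            Literature.NumberTheory.EllipticCurves.resOfLe (WeierstrassCurve.geomTorsion W (p : ℤ))
                (κ.invTwist.kerSubgroup_le_layerSubgroup n) yn =
              Literature.NumberTheory.EllipticCurves.resOfLe (WeierstrassCurve.geomTorsion W (p : ℤ))
                (κ.kerSubgroup_unitTwist (-1)).le y →
            κ.invTwist.twistModPH1Equiv (W.torsionGaloisModule (p : ℤ))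
              (fun P : WeierstrassCurve.geomTorsion W (p : ℤ) => AddSubgroup.torsionBy.nsmul P) n Y = yn →
            galoisCohomology.map (κ.invTwist.twistModPShiftEmbed (W.torsionGaloisModule (p : ℤ))
              (fun P : WeierstrassCurve.geomTorsion W (p : ℤ) => AddSubgroup.torsionBy.nsmul P) (p ^ n) hJn)
                1 Ψ =
              (κ.invTwist.shiftH1 (W.torsionGaloisModule (p : ℤ))
                (fun P : WeierstrassCurve.geomTorsion W (p : ℤ) => AddSubgroup.torsionBy.nsmul P)
                (p ^ n))^[k] Y →
            ∀ ε' : ℕ, εp ≤ ε' →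
              galoisCohomology.localization (W.modPTwist p κ.invTwist (J + 1)) (Sum.inr v) 1
                ((κ.invTwist.shiftH1 (W.torsionGaloisModule (p : ℤ))
                  (fun P : WeierstrassCurve.geomTorsion W (p : ℤ) => AddSubgroup.torsionBy.nsmul P)
                  (J + 1))^[ε'] Ψ) = 0 := by
  intro W _ _ p _ κ γ hp2 _ hκ hγ _ _
  classical
  have hp : p.Prime := Fact.out
  by_cases hex : ∃ v₀ : HeightOneSpectrum (𝓞 ℚ), ((p : ℕ) : 𝓞 ℚ) ∈ v₀.asIdeal
  swap
  · exact ⟨0, fun v hv => absurd ⟨v, hv⟩ hex⟩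
  obtain ⟨v₀, hv₀⟩ := hex
  -- a depth element for `κ⁻¹` over `p`, acting trivially on `E[p]` (k6-g4), from total ramification (lur-b)
  haveI : Finite (geomTorsion W (p : ℤ)) :=
    WeierstrassCurve.finite_torsionPoints_holds W (AlgebraicClosure ℚ) (Int.natCast_ne_zero.mpr hp.ne_zero)
  obtain ⟨τ, hτ⟩ := exists_apply_absGaloisRestrict_ne_one κ hκ v₀ hv₀
  have hτ' : κ.invTwist (absGaloisRestrict ℚ (v₀.adicCompletion ℚ) τ) ≠ 1 := by
    intro h1
    apply hτ
    apply Multiplicative.toAdd.injective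
    have h2 := congrArg Multiplicative.toAdd h1
    rw [ZpExtension.toAdd_invTwist_apply, toAdd_one, neg_eq_zero] at h2
    rw [h2, toAdd_one]
  obtain ⟨g, m, hg, -, hgm, hgm'⟩ := LocalSplitPrime.exists_trivial_depth_of_apply_ne_one
    (W.torsionGaloisModule (p : ℤ)) κ.invTwist v₀ τ hτ'
  have hd : Nat.card (geomTorsion W (p : ℤ)) ≤ p ^ Nat.card (geomTorsion W (p : ℤ)) :=
    (Nat.lt_pow_self hp.one_lt).le
  have h3 : ∃ e : ℕ, ∀ {J L : ℕ} (hJL : J ≤ L) (c : galoisCohomology (W.modPTwist p κ.invTwist J) 1),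
      galoisCohomology.localization (W.modPTwist p κ.invTwist L) (Sum.inr v₀) 1
          (galoisCohomology.map (κ.invTwist.twistModPShiftEmbed (W.torsionGaloisModule (p : ℤ))
            (fun P : geomTorsion W (p : ℤ) => AddSubgroup.torsionBy.nsmul P) L hJL) 1 c) = 0 →
        galoisCohomology.localization (W.modPTwist p κ.invTwist J) (Sum.inr v₀) 1
          ((κ.invTwist.shiftH1 (W.torsionGaloisModule (p : ℤ))
            (fun P : geomTorsion W (p : ℤ) => AddSubgroup.torsionBy.nsmul P) J)^[e] c) = 0 :=
    ⟨Nat.card (geomTorsion W (p : ℤ)) * p ^ m, fun hJL c hc =>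
      localization_shiftH1_iterate_eq_zero_of_localization_map_shiftEmbed_eq_zero
        (W.torsionGaloisModule (p : ℤ)) (fun P : geomTorsion W (p : ℤ) => AddSubgroup.torsionBy.nsmul P)
        κ.invTwist v₀ hg hgm hgm' hd hJL c hc⟩
  obtain ⟨εp, hεp⟩ := localP_of W κ v₀ hp2 hγ hv₀
    (fun g => exists_mem_decomp_inv_mul_mem_kerSubgroup κ hκ v₀ hv₀ g) h3
  refine ⟨εp, fun v hv => ?_⟩
  obtain rfl := Literature.NumberTheory.Automorphic.heightOneSpectrum_rat_eq_of_natCast_mem hp hv hv₀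
  exact hεp

/-! ## §2 The stub without the binder -/

/-- **The registered stub `stub_selmerDualOdd` of skeleton v6 (crux 19276) WITHOUT the binder `ρ̄_{E,p}` not onto**,
for every `E/ℚ` with `E[p]` irreducible and `p ≠ 2`: lur-a's (L-p)-only re-assembly `stub_selmerDualOdd_of_localP`
re-elaborated verbatim with the binder deleted and its three local inputs taken from `localBadIrr`, `localPIrr`,
`localUnramifiedIrr` (each of which never used the binder).  MU-TRANSFER-PROOF §5 STEP 1 (Selmer side).
[cite: GreenbergLNM1716, §3] [cite: MazurRubin2004, §5.3] -/
theorem stub_selmerDualIrr_holds :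
    ∀ (W : WeierstrassCurve ℚ) [W.IsElliptic] [W.IsGloballyMinimal] (p : ℕ) [Fact p.Prime]
      (κ : ZpExtension ℚ p) (γ : absoluteGaloisGroup ℚ),
      p ≠ 2 → W.HasIrreducibleModPGaloisRep p →
      κ.IsCyclotomic → κ.IsTopGenerator γ →
      (∀ v : HeightOneSpectrum (𝓞 ℚ), localEulerPoincareCharacteristic (v.adicCompletion ℚ)) →
      poitouTate_sum_localTatePairing_eq_zero ℚ →
      ∀ (S₀ : Set (HeightOneSpectrum (𝓞 ℚ))), S₀.Finite →
      ∃ (ε : ℕ) (S : Set (HeightOneSpectrum (𝓞 ℚ))), S.Finite ∧ S₀ ⊆ S ∧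
        ∀ (J : ℕ) (y : Literature.NumberTheory.EllipticCurves.subgroupH1 κ.kerSubgroup
            (WeierstrassCurve.geomTorsion W (p : ℤ))),
          W.torsionToPrimaryH1Sub p κ.kerSubgroup y ∈ W.fineSelmerInfty κ →
          (⇑(Literature.NumberTheory.EllipticCurves.conjH1 κ.kerSubgroup
              (WeierstrassCurve.geomTorsion W (p : ℤ)) γ -
            AddMonoidHom.id (Literature.NumberTheory.EllipticCurves.subgroupH1 κ.kerSubgroup
              (WeierstrassCurve.geomTorsion W (p : ℤ)))))^[J] y ≠ 0 →
          ∃ Ψ : galoisCohomology (W.modPTwist p κ.invTwist (J + 1)) 1,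
            (κ.invTwist.shiftH1 (W.torsionGaloisModule (p : ℤ))
                (fun P : WeierstrassCurve.geomTorsion W (p : ℤ) => AddSubgroup.torsionBy.nsmul P)
                (J + 1))^[J] Ψ ≠ 0 ∧
            (∀ v : HeightOneSpectrum (𝓞 ℚ), v ∉ S →
              galoisCohomology.localization (W.modPTwist p κ.invTwist (J + 1)) (Sum.inr v) 1 Ψ ∈
                DiscreteGaloisModule.unramifiedSubgroup
                  (GaloisRep.toLocal v (W.modPTwist p κ.invTwist (J + 1))) 1) ∧
            (∀ v : HeightOneSpectrum (𝓞 ℚ), v ∈ S →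
              galoisCohomology.localization (W.modPTwist p κ.invTwist (J + 1)) (Sum.inr v) 1
                ((κ.invTwist.shiftH1 (W.torsionGaloisModule (p : ℤ))
                  (fun P : WeierstrassCurve.geomTorsion W (p : ℤ) => AddSubgroup.torsionBy.nsmul P)
                  (J + 1))^[ε] Ψ) = 0) := by
  intro W _ _ p _ κ γ hp2 hirr hκ hγ hEP hPT S₀ hS₀
  have hp : p.Prime := Fact.out
  -- the local inputs for this `(W, p, κ, γ)`
  have hbad := localBadIrr W p κ γ hp2 hirr hκ hγ hEP hPT
  obtain ⟨εp, hpl⟩ := localPIrr W p κ γ hp2 hirr hκ hγ hEP hPT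
  have hur := localUnramifiedIrr W p κ γ hp2 hirr hκ hγ
  -- the exceptional set `S ⊇ S₀`: off `S`, `v ∤ p`, good reduction, `E[p]` unramified
  obtain ⟨S, hS, hS₀S, hSoff⟩ :=
    TorsionUnramified.exists_finite_superset_isUnramifiedAt_torsionGaloisModule W hp.ne_zero hS₀
  -- the uniform exponent: `ε = εp + max_{v ∈ S, v ∤ p} ε_v`
  let f : HeightOneSpectrum (𝓞 ℚ) → ℕ := fun v =>
    if h : ((p : ℕ) : 𝓞 ℚ) ∉ v.asIdeal then Classical.choose (hbad v h) else 0
  have hf : ∀ (v : HeightOneSpectrum (𝓞 ℚ)) (h : ((p : ℕ) : 𝓞 ℚ) ∉ v.asIdeal)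
      (J : ℕ) (c : galoisCohomology (W.modPTwist p κ.invTwist J) 1),
      galoisCohomology.localization (W.modPTwist p κ.invTwist J) (Sum.inr v) 1
        ((κ.invTwist.shiftH1 (W.torsionGaloisModule (p : ℤ))
          (fun P : WeierstrassCurve.geomTorsion W (p : ℤ) => AddSubgroup.torsionBy.nsmul P) J)^[f v] c) = 0 := by
    intro v h J c
    have hfv : f v = Classical.choose (hbad v h) := dif_pos h
    rw [hfv]
    exact Classical.choose_spec (hbad v h) J c
  set ε : ℕ := εp + hS.toFinset.sup f with hεdef
  refine ⟨ε, S, hS, hS₀S, fun J y hy hyT => ?_⟩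
  -- the algebraic half: `Y = Sh⁻¹(y_n)` at a layer `n` with `J + 1 ≤ p^n`, then the avatar `Ψ`
  obtain ⟨n₀, hn₀⟩ := exists_invTwist_class_of_iterate_ne_zero W p κ hγ J y hyT
  set n : ℕ := max n₀ (J + 1) with hndef
  have hJn : J + 1 ≤ p ^ n :=
    le_trans (le_max_right n₀ (J + 1)) (Nat.lt_pow_self hp.one_lt).le
  obtain ⟨yn, Y, hyn, hSh, hYT⟩ := hn₀ n (le_max_left n₀ (J + 1))
  have hinv := LevelE.torsionGaloisModule_fixed_eq_zero_of_irr W p hirr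
  obtain ⟨k, Ψ, hΨT, hΨemb⟩ := κ.invTwist.exists_level_class_of_shiftH1_iterate_ne_zero
    (W.torsionGaloisModule (p : ℤ)) (fun P => AddSubgroup.torsionBy.nsmul P) hinv hJn Y hYT
  refine ⟨Ψ, hΨT, fun v hv => ?_, fun v hv => ?_⟩
  · -- unramified off `S`
    obtain ⟨hvp, hgood, hvur⟩ := hSoff v hv
    exact hur v hvp hvur hgood J n hJn y hy yn Y Ψ k hyn hSh hΨemb
  · -- `T^ε`-killed on `S`
    by_cases hvp : ((p : ℕ) : 𝓞 ℚ) ∈ v.asIdeal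
    · exact hpl v hvp J n hJn y hy yn Y Ψ k hyn hSh hΨemb ε (Nat.le_add_right εp _)
    · have hfle : f v ≤ hS.toFinset.sup f := Finset.le_sup (hS.mem_toFinset.mpr hv)
      have hε : ε = f v + (ε - f v) := by omega
      rw [hε, Function.iterate_add_apply]
      exact hf v hvp (J + 1) _

end Summit.BirchSwinnertonDyer.BirchSwinnertonDyer.Rank1Residual.SelmerDual

end
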